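/-
Copyright (c) 2026 the pub-hodgecm-mathlib formalisation cell (harness21).  Prover seat hodgecm-mathlib-F0P3a-p01 (g34), req620 Track A «(D-RAM) FOUR-FRAME» squad, unit U2H:
the (ρ2b′-X) child (U2H ED. 15 :418) — SOCKET (C) (type RamM) seam (C-1cls) «THE CLASS LETTERS hcls0 ∕ hclsT ∕ hclsE ∕ hclsO OF THE (C-1) TABLES» ((C) lead LH4-p04 (g5)
LINE #12 (1); consumer LH4-p06 (g5) ★ p858235 `…RamMTables.ncard_levelSet_eq_hnP` :83–:87 and ★ `…RamMTablesAniso.ncard_levelSet_eq_hnM` :206–:210, byte-exact).  2026-09-04.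
-/
import Summits.HodgeConjecture.HodgeConjecture.Theorems.F0P3cDyRamClassLettersRelative   -- ★ p858188 (this seat): `norm_or_anchored_of_even` (the Θ unit-norm dichotomy anchored at `n₀`, at even order)
import Summits.HodgeConjecture.HodgeConjecture.Theorems.F0P3cDyRamEisensteinDepthRamK     -- ★ p858216 (LH4-p13 (g6)): `eq_exp_of_mul_self_eq` (square roots in `ℤᵐ⁰`)
import HarnessLib

/-!
# Crux `H413`, line LH4 «(D-RAM) FOUR-FRAME» road — unit U2H, (ρ2b′-X), SOCKET (C): THE CLASS LETTERS OF THE (C-1) TABLES, TYPE RamM (seam (C-1cls))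

Cell `hodgecm-mathlib` (D-0151), FLOOR 0, crux item H413 = `stmt-HodgeConjecture-24833`, route of record `HCCMUnconditional`; squad F0∕P3c∕LH4; registered stub served:
`F0P3cDyRamFourFrameU2H.stub_U2H_fixedPointCensus_typeTwo_unit0` ((ρ2b′-X), U2H ED. 15 :418) through the typed bottom socket (C) `SOCKET-hOCC.v1` (869d0c15; type RamM,
`e(M ∕ L⁺_v) = 4`).  LH4-p06 (g5)'s u-free tables ★ `ncard_levelSet_eq_hnP` ∕ ★ `ncard_levelSet_eq_hnM` take four CLASS LETTERS about the scalar `h` of the line model, indexed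
by `k₀ : ℤ`, with `η(k₀) := ρh∕h · t(α^{k₀})`, `t(y) := ρ(y·Θy)∕(y·Θy)`, `|h| = exp(−v_h)`, `v_h + d_ρ = 2e`, `2d′ = d_ρ + 2s0`:
`hcls0 : |1 + η(k₀)| ≤ exp(−(2d′ − 2))`; `hclsT : k₀ + s0 + e even → ∃ ω₀ ∈ U_M, η(k₀)·t(ω₀) = −1` (h hyperbolic); `hclsE : … → ∃ ω₀ ∈ U_M, η(k₀)·t(ω₀)·(ρn₀∕n₀) = −1`
(h anisotropic); `hclsO : k₀ + s0 + e odd → ∀ ω ∈ U_M, ¬ |1 + η(k₀)·t(ω)| ≤ exp(−2d′)`.  THIS FILE PROVES ALL FOUR from the (C-0)∕(C-0b) frame — NO parity token is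
consumed: the parity of the translator class is COMPUTED; §3 supplies the parity letter `he` itself.  THEOREMS ONLY (no `def`, no instance, no notation, no `sorry`); one field `K` (= `M`); lane
`--supports stmt-HodgeConjecture-24833 --as helper` (count-neutral).

THE MATHEMATICS (`K♮ = Fix Θ` inside `M`; `ψ(c) := ρc∕c` for Θ-fixed `c`, so `η(k₀)·t(ω) = ψ(h·N_Θ(α^{k₀})·N_Θ(ω))`, `N_Θ(y) = y·Θy`).  Letters: `ρ, Θ` commuting involutions,
`Θ` isometric; `hF4` (doubly fixed non-zero elements have valuation in `exp(4ℤ)`, ★ p858161 ∕ ★ p858179); a Θ-fixed `P` with `|P| = exp(−2)` and **`|P − ρP| = exp(−2d′)`**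
(★ p858161 `exists_dPrime`: `P = ϖM·ΘϖM`); so `ξ₁ := P − ρP ≠ 0` is Θ-fixed and ρ-ANTI-fixed.
* §1 COORDINATES (as in ★ p858179 `valued_sub_map_le_of_fixed`): a Θ-fixed `c` is `a₀ + b·P` with `a₀, b` doubly fixed and `c − ρc = b·(P − ρP)`; since `|a₀| ∈ exp(4ℤ)` and
  `|bP| ∈ exp(4ℤ − 2)` never tie, `|bP| ≤ |c|`, whence (ψ1) `|c − ρc| ≤ |c|·exp(−(2d′ − 2))` for every Θ-fixed `c ≠ 0`, and (ψ2) `= ` when `|c| ∈ exp(4ℤ + 2)` (then `|c| = |bP|`).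
* §2 `1 + ψ(c) = −(ψ(c∕ξ₁) − 1)` (`ψ(ξ₁) = −1`): **hcls0** is (ψ1) at `c∕ξ₁`; **hclsO** is (ψ2) at `c∕ξ₁`, whose valuation is `exp(−v_h − 2k₀ + 2d′) = exp(4(d′ − r − 1) + 2)` exactly
  when `k₀ + s0 + e = 2r + 1` (`he`, `hds`); **hclsT**: `hhyper` says `a := h·Θx·x` is ρ-anti-fixed, `a∕ξ₁` is doubly fixed so `|a| ∈ exp(4ℤ − 2d′)` pins `|x|`, the even
  parity makes `y := α^{k₀}∕x` of even order `2r′`, and the UNIT `ω₀ := ϖE^{−r′}·x∕α^{k₀}` (`ϖE` a ρ-fixed element of order 2) gives `h·N_Θ(α^{k₀})·N_Θ(ω₀) = a·N_Θ(ϖE^{−r′})`,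
  ρ-anti-fixed, i.e. `η(k₀)·t(ω₀) = −1`; **hclsE**: `h∕ξ₁` is Θ-fixed of even order, so (★ p858188 `norm_or_anchored_of_even`) it is `N_Θ(z)` — impossible, `x := z⁻¹` would make
  `h` hyperbolic against `haniso` — or `N_Θ(z)·n₀ = n₀⁻¹·N_Θ(n₀z)`, and `ω₀ := ϖE^{−r′}∕(n₀·z·α^{k₀})` gives `η(k₀)·t(ω₀) = −n₀∕ρn₀`.
(R-26) inhabitant: ℚ₂(ζ₈) ⊃ ℚ₂(i) (`d′ = 3` for `K♮ = ℚ₂(√±2)`: `|√2 − (−√2)| = |2|·|√2|`, K♮-order 3).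
HONEST LABEL.  Count-neutral helper; (ρ2b′-X) stays an OPEN prover target; `HC_CM` is proved only modulo the 7 printed citations (2 remaining named inputs: hLiu418 =
`stmt-HodgeConjecture-24832`, h413 = `stmt-HodgeConjecture-24833`) until rung 0 closes.

## References
* [Serre1979] J.-P. Serre, *Local Fields*, GTM 67 (1979), Ch. IV §1 Prop. 3–4 (`i_G(σ)` and the different of a quadratic extension), Ch. V §3 Prop. 5 and Cor. 3 (norm-one
  elements and the norm residue class), Ch. III §6 Prop. 13.
* [LabesseLanglands1979] J.-P. Labesse, R. P. Langlands, *L-indistinguishability for SL(2)*, Canad. J. Math. 31 (1979), §2 pp. 7–8 (classes of the quadratic torus by level).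
* [Rogawski1990] J. D. Rogawski, *Automorphic Representations of Unitary Groups in Three Variables*, Ann. of Math. Stud. 123 (1990), §4.9 Lemma 4.9.3 p. 56, Prop. 4.9.1 (b) p. 55.
-/

set_option autoImplicit false

noncomputable section

open WithZero
open Summit.HodgeConjecture.HodgeConjecture.Cruxes.H413.F0P3cDyRamClassLettersRelative (norm_or_anchored_of_even)
open Summit.HodgeConjecture.HodgeConjecture.Cruxes.H413.F0P3cDyRamEisensteinDepthRamK (eq_exp_of_mul_self_eq)
open scoped Valued

namespace Summit.HodgeConjecture.HodgeConjecture.Cruxes.H413.F0P3cDyRamClassLettersRamM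

variable {K : Type} [Field K] [Valued K ℤᵐ⁰] {ρ Θ : K →+* K}

/-! ## §0 Algebra of `η(k₀)·t(ω) = ψ(h·N·N′)` -/

omit [Valued K ℤᵐ⁰] in
/-- `ρh∕h · ρN∕N = ρ(hN)∕(hN)`. [cite: Rogawski1990, §4.9 Lemma 4.9.3 p. 56] -/
theorem div_mul_div_eq_map_mul_div (ρ : K →+* K) {h N : K} (hh : h ≠ 0) (hN : N ≠ 0) :
    ρ h / h * (ρ N / N) = ρ (h * N) / (h * N) := by
  rw [map_mul]; field_simp

omit [Valued K ℤᵐ⁰] in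
/-- `ρh∕h · ρN∕N · ρN′∕N′ = ρ(hNN′)∕(hNN′)`. [cite: Rogawski1990, §4.9 Lemma 4.9.3 p. 56] -/
theorem div_mul_div_mul_div_eq_map_mul_div (ρ : K →+* K) {h N M : K} (hh : h ≠ 0) (hN : N ≠ 0) (hM : M ≠ 0) :
    ρ h / h * (ρ N / N) * (ρ M / M) = ρ (h * N * M) / (h * N * M) := by
  rw [map_mul, map_mul]; field_simp

omit [Valued K ℤᵐ⁰] in
/-- `ψ(ξ·g) = −ψ(g)` for a ρ-anti-fixed `ξ`: `1 + ρ(ξg)∕(ξg) = −(ρg∕g − 1)`. [cite: Serre1979, Ch. V §3 Prop. 5] -/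
theorem one_add_map_mul_div_eq {ξ g : K} (hξ : ξ ≠ 0) (hg : g ≠ 0) (hρξ : ρ ξ = -ξ) :
    1 + ρ (ξ * g) / (ξ * g) = -(ρ g / g - 1) := by
  rw [map_mul, hρξ]; field_simp; ring

/-! ## §1 Coordinates of a Θ-fixed element along `P`, and the valuation of `c − ρc` -/

omit [Valued K ℤᵐ⁰] in
/-- COORDINATES: a Θ-fixed `c` is `a₀ + b·P` with `a₀, b` fixed by `ρ` and `Θ`, and `c − ρc = b·(P − ρP)` (`b := (c − ρc)∕(P − ρP)`).
[cite: Serre1979, Ch. IV §1 Prop. 3–4] [cite: LabesseLanglands1979, §2 pp. 7–8] -/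
theorem thetaFixed_coords (hρρ : ∀ x, ρ (ρ x) = x) (hΘρ : ∀ x, Θ (ρ x) = ρ (Θ x))
    {P : K} (hΘP : Θ P = P) (hPρ : P - ρ P ≠ 0) {c : K} (hΘc : Θ c = c) :
    ∃ a₀ b : K, ρ a₀ = a₀ ∧ Θ a₀ = a₀ ∧ ρ b = b ∧ Θ b = b ∧ c = a₀ + b * P ∧ c - ρ c = b * (P - ρ P) := by
  set b : K := (c - ρ c) / (P - ρ P) with hb
  have hρb : ρ b = b := by
    rw [hb, map_div₀, map_sub, map_sub, hρρ, hρρ, ← neg_sub c, ← neg_sub P, neg_div_neg_eq]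
  have hΘb : Θ b = b := by
    rw [hb, map_div₀, map_sub, map_sub, hΘρ, hΘρ, hΘc, hΘP]
  have hkey : c - ρ c = b * (P - ρ P) := by rw [hb, div_mul_cancel₀ _ hPρ]
  refine ⟨c - b * P, b, ?_, ?_, hρb, hΘb, by ring, hkey⟩
  · have h1 : (c - b * P) - ρ (c - b * P) = (c - ρ c) - b * (P - ρ P) := by rw [map_sub, map_mul, hρb]; ring
    rw [hkey, sub_self, sub_eq_zero] at h1
    exact h1.symm
  · rw [map_sub, map_mul, hΘb, hΘc, hΘP]

/-- (ψ1) **`|c − ρc| ≤ |c|·exp(−(2d′ − 2))`** for every Θ-fixed `c` (`|P| = exp(−2)`, `|P − ρP| = exp(−2d′)`, doubly fixed elements in `exp(4ℤ)`): in coordinates `|bP| ≤ |c|`.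
[cite: Serre1979, Ch. IV §1 Prop. 3–4] -/
theorem v_sub_map_le_mul_of_thetaFixed (hρρ : ∀ x, ρ (ρ x) = x) (hΘρ : ∀ x, Θ (ρ x) = ρ (Θ x))
    (hF4 : ∀ f : K, ρ f = f → Θ f = f → f ≠ 0 → ∃ n : ℤ, Valued.v f = exp (4 * n))
    {P : K} (hΘP : Θ P = P) (hvP : Valued.v P = exp (-2 : ℤ)) {d' : ℕ} (hdP : Valued.v (P - ρ P) = exp (-(2 * (d' : ℤ))))
    {c : K} (hΘc : Θ c = c) : Valued.v (c - ρ c) ≤ Valued.v c * exp (-(2 * (d' : ℤ) - 2)) := by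
  have hPρ : P - ρ P ≠ 0 := fun h0 => by rw [h0, map_zero] at hdP; exact (exp_ne_zero hdP.symm).elim
  obtain ⟨a₀, b, hρa₀, hΘa₀, hρb, hΘb, hc, hkey⟩ := thetaFixed_coords hρρ hΘρ hΘP hPρ hΘc
  rcases eq_or_ne b 0 with hb0 | hb0
  · rw [hkey, hb0, zero_mul, map_zero]; exact zero_le
  obtain ⟨n, hn⟩ := hF4 b hρb hΘb hb0
  have hvbP : Valued.v (b * P) = exp (4 * n - 2) := by rw [Valuation.map_mul, hn, hvP, ← exp_add]; rfl
  -- `|bP| ≤ |c|`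
  have hle : Valued.v (b * P) ≤ Valued.v c := by
    rcases eq_or_ne a₀ 0 with h0 | h0
    · rw [hc, h0, zero_add]
    · obtain ⟨m, hm⟩ := hF4 a₀ hρa₀ hΘa₀ h0
      have hne : Valued.v a₀ ≠ Valued.v (b * P) := by rw [hm, hvbP, Ne, exp_inj]; omega
      rw [hc, Valuation.map_add_of_distinct_val _ hne]
      exact le_max_right _ _
  rw [hkey, Valuation.map_mul, hdP]
  calc Valued.v b * exp (-(2 * (d' : ℤ))) = Valued.v (b * P) * exp (-(2 * (d' : ℤ) - 2)) := by
        rw [hvbP, hn, ← exp_add, ← exp_add]; congr 1; ring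
    _ ≤ Valued.v c * exp (-(2 * (d' : ℤ) - 2)) := mul_le_mul_left hle _

/-- (ψ2) **`|c − ρc| = |c|·exp(−(2d′ − 2))`** for a Θ-fixed `c` of valuation in `exp(4ℤ + 2)` (K♮-order odd): in coordinates `|c| = |bP|`. [cite: Serre1979, Ch. IV §1 Prop. 3–4] -/
theorem v_sub_map_eq_mul_of_thetaFixed_odd (hρρ : ∀ x, ρ (ρ x) = x) (hΘρ : ∀ x, Θ (ρ x) = ρ (Θ x))
    (hF4 : ∀ f : K, ρ f = f → Θ f = f → f ≠ 0 → ∃ n : ℤ, Valued.v f = exp (4 * n))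
    {P : K} (hΘP : Θ P = P) (hvP : Valued.v P = exp (-2 : ℤ)) {d' : ℕ} (hdP : Valued.v (P - ρ P) = exp (-(2 * (d' : ℤ))))
    {c : K} (hΘc : Θ c = c) {n : ℤ} (hvc : Valued.v c = exp (4 * n + 2)) :
    Valued.v (c - ρ c) = Valued.v c * exp (-(2 * (d' : ℤ) - 2)) := by
  have hPρ : P - ρ P ≠ 0 := fun h0 => by rw [h0, map_zero] at hdP; exact (exp_ne_zero hdP.symm).elim
  obtain ⟨a₀, b, hρa₀, hΘa₀, hρb, hΘb, hc, hkey⟩ := thetaFixed_coords hρρ hΘρ hΘP hPρ hΘc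
  have hc0 : c ≠ 0 := fun h0 => by rw [h0, map_zero] at hvc; exact (exp_ne_zero hvc.symm).elim
  have hb0 : b ≠ 0 := by
    intro hb0
    rw [hb0, zero_mul, add_zero] at hc
    obtain ⟨m, hm⟩ := hF4 c (by rw [hc, hρa₀]) hΘc hc0
    rw [hvc, exp_inj] at hm
    omega
  obtain ⟨k, hk⟩ := hF4 b hρb hΘb hb0
  have hvbP : Valued.v (b * P) = exp (4 * k - 2) := by rw [Valuation.map_mul, hk, hvP, ← exp_add]; rfl
  -- `|c| = |bP|`
  have heq : Valued.v c = Valued.v (b * P) := by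
    rcases eq_or_ne a₀ 0 with h0 | h0
    · rw [hc, h0, zero_add]
    · obtain ⟨m, hm⟩ := hF4 a₀ hρa₀ hΘa₀ h0
      have hne : Valued.v a₀ ≠ Valued.v (b * P) := by rw [hm, hvbP, Ne, exp_inj]; omega
      have hmax := Valuation.map_add_of_distinct_val Valued.v hne
      rw [← hc] at hmax
      rcases max_choice (Valued.v a₀) (Valued.v (b * P)) with h1 | h1
      · exfalso
        rw [h1, hm, hvc, exp_inj] at hmax
        omega
      · rw [hmax, h1]
  rw [hkey, Valuation.map_mul, hdP, heq, hvbP, hk, ← exp_add, ← exp_add]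
  congr 1; ring

/-- **`|ψ(g) − 1| ≤ exp(−(2d′ − 2))`** for every Θ-fixed `g ≠ 0` (`ψ(g) = ρg∕g`: the norm-one classes of `K♮ ∕ F` lie within K♮-depth `d′ − 1` of `1`).
[cite: Serre1979, Ch. V §3 Prop. 5] [cite: LabesseLanglands1979, §2 pp. 7–8] -/
theorem v_map_div_sub_one_le (hρρ : ∀ x, ρ (ρ x) = x) (hΘρ : ∀ x, Θ (ρ x) = ρ (Θ x))
    (hF4 : ∀ f : K, ρ f = f → Θ f = f → f ≠ 0 → ∃ n : ℤ, Valued.v f = exp (4 * n))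
    {P : K} (hΘP : Θ P = P) (hvP : Valued.v P = exp (-2 : ℤ)) {d' : ℕ} (hdP : Valued.v (P - ρ P) = exp (-(2 * (d' : ℤ))))
    {g : K} (hΘg : Θ g = g) (hg0 : g ≠ 0) : Valued.v (ρ g / g - 1) ≤ exp (-(2 * (d' : ℤ) - 2)) := by
  have hvg : 0 < Valued.v g := zero_lt_iff.2 ((Valuation.ne_zero_iff _).2 hg0)
  rw [div_sub_one hg0, map_div₀, Valuation.map_sub_swap, div_le_iff₀ hvg, mul_comm]
  exact v_sub_map_le_mul_of_thetaFixed hρρ hΘρ hF4 hΘP hvP hdP hΘg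

/-- **`|ψ(g) − 1| = exp(−(2d′ − 2))`** for a Θ-fixed `g` with `|g| ∈ exp(4ℤ + 2)`. [cite: Serre1979, Ch. V §3 Prop. 5] [cite: LabesseLanglands1979, §2 pp. 7–8] -/
theorem v_map_div_sub_one_eq_of_odd (hρρ : ∀ x, ρ (ρ x) = x) (hΘρ : ∀ x, Θ (ρ x) = ρ (Θ x))
    (hF4 : ∀ f : K, ρ f = f → Θ f = f → f ≠ 0 → ∃ n : ℤ, Valued.v f = exp (4 * n))
    {P : K} (hΘP : Θ P = P) (hvP : Valued.v P = exp (-2 : ℤ)) {d' : ℕ} (hdP : Valued.v (P - ρ P) = exp (-(2 * (d' : ℤ))))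
    {g : K} (hΘg : Θ g = g) {n : ℤ} (hvg : Valued.v g = exp (4 * n + 2)) : Valued.v (ρ g / g - 1) = exp (-(2 * (d' : ℤ) - 2)) := by
  have hg0 : g ≠ 0 := fun h0 => by rw [h0, map_zero] at hvg; exact (exp_ne_zero hvg.symm).elim
  have hvg0 : Valued.v g ≠ 0 := (Valuation.ne_zero_iff _).2 hg0
  rw [div_sub_one hg0, map_div₀, Valuation.map_sub_swap, v_sub_map_eq_mul_of_thetaFixed_odd hρρ hΘρ hF4 hΘP hvP hdP hΘg hvg,
    mul_div_cancel_left₀ _ hvg0]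

/-! ## §2 The four class letters -/

/-- **`hcls0`**: `|1 + η(k₀)| ≤ exp(−(2d′ − 2))` for every `k₀ : ℤ` (`h` any Θ-fixed non-zero scalar, `α ≠ 0`). [cite: Serre1979, Ch. V §3 Prop. 5]
[cite: LabesseLanglands1979, §2 pp. 7–8] -/
theorem hcls0_ramM (hρρ : ∀ x, ρ (ρ x) = x) (hΘΘ : ∀ x, Θ (Θ x) = x) (hΘρ : ∀ x, Θ (ρ x) = ρ (Θ x))
    (hF4 : ∀ f : K, ρ f = f → Θ f = f → f ≠ 0 → ∃ n : ℤ, Valued.v f = exp (4 * n))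
    {P : K} (hΘP : Θ P = P) (hvP : Valued.v P = exp (-2 : ℤ)) {d' : ℕ} (hdP : Valued.v (P - ρ P) = exp (-(2 * (d' : ℤ))))
    {α : K} (hα0 : α ≠ 0) {h : K} (hΘh : Θ h = h) (hh : h ≠ 0) (k₀ : ℤ) :
    Valued.v (1 + ρ h / h * (ρ (α ^ k₀ * Θ (α ^ k₀)) / (α ^ k₀ * Θ (α ^ k₀)))) ≤ exp (-(2 * (d' : ℤ) - 2)) := by
  have hξ0 : P - ρ P ≠ 0 := fun h0 => by rw [h0, map_zero] at hdP; exact (exp_ne_zero hdP.symm).elim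
  have hΘξ : Θ (P - ρ P) = P - ρ P := by rw [map_sub, hΘρ, hΘP]
  have hρξ : ρ (P - ρ P) = -(P - ρ P) := by rw [map_sub, hρρ, neg_sub]
  have hN0 : α ^ k₀ * Θ (α ^ k₀) ≠ 0 := mul_ne_zero (zpow_ne_zero _ hα0) ((map_ne_zero Θ).2 (zpow_ne_zero _ hα0))
  have hΘN : Θ (α ^ k₀ * Θ (α ^ k₀)) = α ^ k₀ * Θ (α ^ k₀) := by rw [map_mul, hΘΘ, mul_comm]
  set g : K := h * (α ^ k₀ * Θ (α ^ k₀)) / (P - ρ P) with hg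
  have hg0 : g ≠ 0 := div_ne_zero (mul_ne_zero hh hN0) hξ0
  have hΘg : Θ g = g := by rw [hg, map_div₀, map_mul, hΘh, hΘN, hΘξ]
  have hc : h * (α ^ k₀ * Θ (α ^ k₀)) = (P - ρ P) * g := by rw [hg, mul_div_cancel₀ _ hξ0]
  rw [div_mul_div_eq_map_mul_div ρ hh hN0, hc, one_add_map_mul_div_eq hξ0 hg0 hρξ, Valuation.map_neg]
  exact v_map_div_sub_one_le hρρ hΘρ hF4 hΘP hvP hdP hΘg hg0

/-- **`hclsO`**: for `k₀ + s0 + e` ODD, no unit twist meets the class at K♮-depth `d′`: `¬ |1 + η(k₀)·t(ω)| ≤ exp(−2d′)` for every unit `ω` — the twisted element over `ξ₁` has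
valuation `exp(4(d′ − r − 1) + 2)`, so (ψ2) gives `|1 + η(k₀)·t(ω)| = exp(−(2d′ − 2))` on the nose. [cite: Serre1979, Ch. V §3 Prop. 5] [cite: LabesseLanglands1979, §2 pp. 7–8]
[cite: Rogawski1990, §4.9 Prop. 4.9.1 (b) p. 55] -/
theorem hclsO_ramM (hρρ : ∀ x, ρ (ρ x) = x) (hΘΘ : ∀ x, Θ (Θ x) = x) (hΘρ : ∀ x, Θ (ρ x) = ρ (Θ x)) (hvΘ : ∀ x, Valued.v (Θ x) = Valued.v x)
    (hF4 : ∀ f : K, ρ f = f → Θ f = f → f ≠ 0 → ∃ n : ℤ, Valued.v f = exp (4 * n))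
    {P : K} (hΘP : Θ P = P) (hvP : Valued.v P = exp (-2 : ℤ)) {d' : ℕ} (hdP : Valued.v (P - ρ P) = exp (-(2 * (d' : ℤ))))
    {α : K} (hα : Valued.v α = exp (-1 : ℤ)) {h : K} (hΘh : Θ h = h) (hh : h ≠ 0) {vh : ℤ} (hvh : Valued.v h = exp (-vh))
    {dρ s0 : ℕ} {e : ℤ} (he : vh + dρ = 2 * e) (hds : 2 * d' = dρ + 2 * s0)
    (k₀ : ℤ) (hodd : ∃ r : ℤ, k₀ + s0 + e = 2 * r + 1) (ω : Kˣ) (hω : Valued.v (ω : K) = 1) :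
    ¬ Valued.v (1 + ρ h / h * (ρ (α ^ k₀ * Θ (α ^ k₀)) / (α ^ k₀ * Θ (α ^ k₀))) * (ρ ((ω : K) * Θ ω) / ((ω : K) * Θ ω))) ≤
      exp (-(2 * (d' : ℤ))) := by
  obtain ⟨r, hr⟩ := hodd
  have hα0 : α ≠ 0 := fun h0 => by rw [h0, map_zero] at hα; exact (exp_ne_zero hα.symm).elim
  have hξ0 : P - ρ P ≠ 0 := fun h0 => by rw [h0, map_zero] at hdP; exact (exp_ne_zero hdP.symm).elim
  have hΘξ : Θ (P - ρ P) = P - ρ P := by rw [map_sub, hΘρ, hΘP]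
  have hρξ : ρ (P - ρ P) = -(P - ρ P) := by rw [map_sub, hρρ, neg_sub]
  have hN0 : α ^ k₀ * Θ (α ^ k₀) ≠ 0 := mul_ne_zero (zpow_ne_zero _ hα0) ((map_ne_zero Θ).2 (zpow_ne_zero _ hα0))
  have hΘN : Θ (α ^ k₀ * Θ (α ^ k₀)) = α ^ k₀ * Θ (α ^ k₀) := by rw [map_mul, hΘΘ, mul_comm]
  have hω0 : (ω : K) ≠ 0 := ω.ne_zero
  have hM0 : (ω : K) * Θ ω ≠ 0 := mul_ne_zero hω0 ((map_ne_zero Θ).2 hω0)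
  have hΘM : Θ ((ω : K) * Θ ω) = (ω : K) * Θ ω := by rw [map_mul, hΘΘ, mul_comm]
  set g : K := h * (α ^ k₀ * Θ (α ^ k₀)) * ((ω : K) * Θ ω) / (P - ρ P) with hg
  have hg0 : g ≠ 0 := div_ne_zero (mul_ne_zero (mul_ne_zero hh hN0) hM0) hξ0
  have hΘg : Θ g = g := by rw [hg, map_div₀, map_mul, map_mul, hΘh, hΘN, hΘM, hΘξ]
  have hc : h * (α ^ k₀ * Θ (α ^ k₀)) * ((ω : K) * Θ ω) = (P - ρ P) * g := by rw [hg, mul_div_cancel₀ _ hξ0]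
  -- the valuation of `g`: `exp(−vh − 2k₀ + 2d′) = exp(4(d′ − r − 1) + 2)`
  have hvg : Valued.v g = exp (4 * ((d' : ℤ) - r - 1) + 2) := by
    rw [hg, map_div₀, Valuation.map_mul, Valuation.map_mul, Valuation.map_mul, Valuation.map_mul, hvΘ, hvΘ, map_zpow₀, hvh, hα, hω,
      hdP, ← exp_zsmul, mul_one, mul_one, ← exp_add, ← exp_add, ← exp_sub]
    congr 1
    simp only [smul_eq_mul]
    omega
  rw [div_mul_div_mul_div_eq_map_mul_div ρ hh hN0 hM0, hc, one_add_map_mul_div_eq hξ0 hg0 hρξ, Valuation.map_neg,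
    v_map_div_sub_one_eq_of_odd hρρ hΘρ hF4 hΘP hvP hdP hΘg hvg, exp_le_exp]
  omega

/-- **`hclsT`** (h HYPERBOLIC): for `k₀ + s0 + e` EVEN there is a unit `ω₀` with `η(k₀)·t(ω₀) = −1`.  Letters: `hhyper` (★ p858188 bytes), `ϖE` a ρ-fixed element with
`|ϖE| = exp(−2)`, `|α| = exp(−1)`. [cite: Serre1979, Ch. V §3 Prop. 5 and Cor. 3] [cite: LabesseLanglands1979, §2 pp. 7–8] [cite: Rogawski1990, §4.9 Lemma 4.9.3 p. 56] -/
theorem hclsT_ramM (hρρ : ∀ x, ρ (ρ x) = x) (hΘΘ : ∀ x, Θ (Θ x) = x) (hΘρ : ∀ x, Θ (ρ x) = ρ (Θ x)) (hvΘ : ∀ x, Valued.v (Θ x) = Valued.v x)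
    (hF4 : ∀ f : K, ρ f = f → Θ f = f → f ≠ 0 → ∃ n : ℤ, Valued.v f = exp (4 * n))
    {P : K} (hΘP : Θ P = P) {d' : ℕ} (hdP : Valued.v (P - ρ P) = exp (-(2 * (d' : ℤ))))
    {α : K} (hα : Valued.v α = exp (-1 : ℤ)) {ϖE : K} (hϖE : Valued.v ϖE = exp (-2 : ℤ)) (hρϖ : ρ ϖE = ϖE)
    {h : K} (hΘh : Θ h = h) (hh : h ≠ 0) {vh : ℤ} (hvh : Valued.v h = exp (-vh))
    {dρ s0 : ℕ} {e : ℤ} (he : vh + dρ = 2 * e) (hds : 2 * d' = dρ + 2 * s0)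
    (hhyper : ∃ x : K, x ≠ 0 ∧ h * Θ x * x + ρ (h * Θ x * x) = 0)
    (k₀ : ℤ) (heven : ∃ r : ℤ, k₀ + s0 + e = 2 * r) :
    ∃ ω₀ : Kˣ, Valued.v (ω₀ : K) = 1 ∧
      ρ h / h * (ρ (α ^ k₀ * Θ (α ^ k₀)) / (α ^ k₀ * Θ (α ^ k₀))) * (ρ ((ω₀ : K) * Θ ω₀) / ((ω₀ : K) * Θ ω₀)) = -1 := by
  obtain ⟨r, hr⟩ := heven
  obtain ⟨x, hx0, hx⟩ := hhyper
  have hα0 : α ≠ 0 := fun h0 => by rw [h0, map_zero] at hα; exact (exp_ne_zero hα.symm).elim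
  have hϖ0 : ϖE ≠ 0 := fun h0 => by rw [h0, map_zero] at hϖE; exact (exp_ne_zero hϖE.symm).elim
  have hξ0 : P - ρ P ≠ 0 := fun h0 => by rw [h0, map_zero] at hdP; exact (exp_ne_zero hdP.symm).elim
  have hΘξ : Θ (P - ρ P) = P - ρ P := by rw [map_sub, hΘρ, hΘP]
  have hρξ : ρ (P - ρ P) = -(P - ρ P) := by rw [map_sub, hρρ, neg_sub]
  have hΘx0 : Θ x ≠ 0 := (map_ne_zero Θ).2 hx0
  -- `a := h·Θx·x` is ρ-anti-fixed and Θ-fixed; `a∕ξ₁` is doubly fixed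
  have hρa : ρ (h * Θ x * x) = -(h * Θ x * x) := (neg_eq_of_add_eq_zero_right hx).symm
  have hΘa : Θ (h * Θ x * x) = h * Θ x * x := by rw [map_mul, map_mul, hΘh, hΘΘ]; ring
  have ha0 : h * Θ x * x ≠ 0 := mul_ne_zero (mul_ne_zero hh hΘx0) hx0
  obtain ⟨n, hn⟩ := hF4 (h * Θ x * x / (P - ρ P)) (by rw [map_div₀, hρa, hρξ, neg_div_neg_eq]) (by rw [map_div₀, hΘa, hΘξ])
    (div_ne_zero ha0 hξ0)
  -- `|x| = exp m′`
  have hxx : Valued.v x * Valued.v x = exp (2 * (2 * n - (dρ : ℤ) - s0 + e)) := by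
    rw [map_div₀, Valuation.map_mul, Valuation.map_mul, hvΘ, hvh, hdP, div_eq_iff (exp_ne_zero), ← exp_add] at hn
    have h1 : Valued.v x * Valued.v x = exp (4 * n + -(2 * (d' : ℤ))) / exp (-vh) := by
      rw [← hn]; field_simp
    rw [h1, ← exp_sub]
    congr 1
    omega
  have hxv : Valued.v x = exp (2 * n - (dρ : ℤ) - s0 + e) := eq_exp_of_mul_self_eq hxx
  -- the unit `ω₀ := ϖE^{−r′}·x∕α^{k₀}`, `r′ := d′ − r − n`
  have hωne : ϖE ^ (-((d' : ℤ) - r - n)) * x / α ^ k₀ ≠ 0 :=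
    div_ne_zero (mul_ne_zero (zpow_ne_zero _ hϖ0) hx0) (zpow_ne_zero _ hα0)
  have hω1 : Valued.v (ϖE ^ (-((d' : ℤ) - r - n)) * x / α ^ k₀) = 1 := by
    rw [map_div₀, Valuation.map_mul, map_zpow₀, map_zpow₀, hϖE, hxv, hα, ← exp_zsmul, ← exp_zsmul, ← exp_add, ← exp_sub, ← exp_zero]
    congr 1
    simp only [smul_eq_mul]
    omega
  refine ⟨Units.mk0 _ hωne, hω1, ?_⟩
  have hN0 : α ^ k₀ * Θ (α ^ k₀) ≠ 0 := mul_ne_zero (zpow_ne_zero _ hα0) ((map_ne_zero Θ).2 (zpow_ne_zero _ hα0))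
  have hM0 : ϖE ^ (-((d' : ℤ) - r - n)) * x / α ^ k₀ * Θ (ϖE ^ (-((d' : ℤ) - r - n)) * x / α ^ k₀) ≠ 0 :=
    mul_ne_zero hωne ((map_ne_zero Θ).2 hωne)
  rw [Units.val_mk0, div_mul_div_mul_div_eq_map_mul_div ρ hh hN0 hM0]
  -- `h·N(α^{k₀})·N(ω₀) = a·N(ϖE^{−r′})`
  have hΘα0 : Θ (α ^ k₀) ≠ 0 := (map_ne_zero Θ).2 (zpow_ne_zero _ hα0)
  have hprod : h * (α ^ k₀ * Θ (α ^ k₀)) * (ϖE ^ (-((d' : ℤ) - r - n)) * x / α ^ k₀ * Θ (ϖE ^ (-((d' : ℤ) - r - n)) * x / α ^ k₀)) =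
      h * Θ x * x * (ϖE ^ (-((d' : ℤ) - r - n)) * Θ (ϖE ^ (-((d' : ℤ) - r - n)))) := by
    rw [map_div₀, map_mul]
    field_simp
  have hρN : ρ (ϖE ^ (-((d' : ℤ) - r - n)) * Θ (ϖE ^ (-((d' : ℤ) - r - n)))) = ϖE ^ (-((d' : ℤ) - r - n)) * Θ (ϖE ^ (-((d' : ℤ) - r - n))) := by
    rw [map_mul, ← hΘρ, map_zpow₀ ρ, hρϖ]
  have hNϖ0 : ϖE ^ (-((d' : ℤ) - r - n)) * Θ (ϖE ^ (-((d' : ℤ) - r - n))) ≠ 0 :=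
    mul_ne_zero (zpow_ne_zero _ hϖ0) ((map_ne_zero Θ).2 (zpow_ne_zero _ hϖ0))
  rw [hprod, map_mul, hρa, hρN, neg_mul, neg_div, div_self (mul_ne_zero ha0 hNϖ0)]

/-- **`hclsE`** (h ANISOTROPIC): for `k₀ + s0 + e` EVEN there is a unit `ω₀` with `η(k₀)·t(ω₀)·(ρn₀∕n₀) = −1`, `n₀` the Θ-fixed unit NON-norm of the Θ unit-norm dichotomy
`(c₀, hdich)`.  Letters: `haniso` (★ p858188 bytes), `ϖE`, `|α| = exp(−1)`. [cite: Serre1979, Ch. V §3 Prop. 5 and Cor. 3] [cite: LabesseLanglands1979, §2 pp. 7–8]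
[cite: Rogawski1990, §4.9 Lemma 4.9.3 p. 56] -/
theorem hclsE_ramM (hρρ : ∀ x, ρ (ρ x) = x) (hΘΘ : ∀ x, Θ (Θ x) = x) (hΘρ : ∀ x, Θ (ρ x) = ρ (Θ x)) (hvΘ : ∀ x, Valued.v (Θ x) = Valued.v x)
    {c₀ : K} (hc₀ : Valued.v c₀ = 1) (hdich : ∀ u : K, Θ u = u → Valued.v u = 1 → (∃ z : K, z * Θ z = u) ∨ ∃ z : K, z * Θ z = c₀ * u)
    {n₀ : K} (hΘn₀ : Θ n₀ = n₀) (hn₀1 : Valued.v n₀ = 1) (hn₀N : ¬ ∃ z : K, z * Θ z = n₀)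
    {P : K} (hΘP : Θ P = P) {d' : ℕ} (hdP : Valued.v (P - ρ P) = exp (-(2 * (d' : ℤ))))
    {α : K} (hα : Valued.v α = exp (-1 : ℤ)) {ϖE : K} (hϖE : Valued.v ϖE = exp (-2 : ℤ)) (hρϖ : ρ ϖE = ϖE)
    {h : K} (hΘh : Θ h = h) (hh : h ≠ 0) {vh : ℤ} (hvh : Valued.v h = exp (-vh))
    {dρ s0 : ℕ} {e : ℤ} (he : vh + dρ = 2 * e) (hds : 2 * d' = dρ + 2 * s0)
    (haniso : ¬ ∃ x : K, x ≠ 0 ∧ h * Θ x * x + ρ (h * Θ x * x) = 0)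
    (k₀ : ℤ) (heven : ∃ r : ℤ, k₀ + s0 + e = 2 * r) :
    ∃ ω₀ : Kˣ, Valued.v (ω₀ : K) = 1 ∧
      ρ h / h * (ρ (α ^ k₀ * Θ (α ^ k₀)) / (α ^ k₀ * Θ (α ^ k₀))) * (ρ ((ω₀ : K) * Θ ω₀) / ((ω₀ : K) * Θ ω₀)) * (ρ n₀ / n₀) = -1 := by
  obtain ⟨r, hr⟩ := heven
  have hα0 : α ≠ 0 := fun h0 => by rw [h0, map_zero] at hα; exact (exp_ne_zero hα.symm).elim
  have hϖ0 : ϖE ≠ 0 := fun h0 => by rw [h0, map_zero] at hϖE; exact (exp_ne_zero hϖE.symm).elim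
  have hn₀0 : n₀ ≠ 0 := fun h0 => by rw [h0, map_zero] at hn₀1; exact zero_ne_one hn₀1
  have hρn₀0 : ρ n₀ ≠ 0 := (map_ne_zero ρ).2 hn₀0
  have hξ0 : P - ρ P ≠ 0 := fun h0 => by rw [h0, map_zero] at hdP; exact (exp_ne_zero hdP.symm).elim
  have hΘξ : Θ (P - ρ P) = P - ρ P := by rw [map_sub, hΘρ, hΘP]
  have hρξ : ρ (P - ρ P) = -(P - ρ P) := by rw [map_sub, hρρ, neg_sub]
  -- `g := h∕ξ₁` is Θ-fixed of even order `2(dρ + s0 − e)`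
  set g : K := h / (P - ρ P) with hg
  have hg0 : g ≠ 0 := div_ne_zero hh hξ0
  have hΘg : Θ g = g := by rw [hg, map_div₀, hΘh, hΘξ]
  have hhg : h = (P - ρ P) * g := by rw [hg, mul_div_cancel₀ _ hξ0]
  have hvg : Valued.v g = exp (2 * ((dρ : ℤ) + s0 - e)) := by
    rw [hg, map_div₀, hvh, hdP, ← exp_sub]
    congr 1
    omega
  rcases norm_or_anchored_of_even hΘΘ hvΘ hc₀ hdich hΘn₀ hn₀1 hn₀N hα hΘg hvg with ⟨z, hz⟩ | ⟨z, hz⟩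
  · -- `h = ξ₁·N(z)` would be hyperbolic
    exfalso
    have hz0 : z ≠ 0 := fun h0 => hg0 (by rw [← hz, h0, zero_mul])
    have hΘz0 : Θ z ≠ 0 := (map_ne_zero Θ).2 hz0
    apply haniso
    refine ⟨z⁻¹, inv_ne_zero hz0, ?_⟩
    have h1 : h * Θ z⁻¹ * z⁻¹ = P - ρ P := by
      rw [hhg, ← hz, map_inv₀]; field_simp
    rw [h1, hρξ, add_neg_cancel]
  · -- `h = ξ₁·N(z)·n₀ = ξ₁·n₀⁻¹·N(n₀z)`
    have hz0 : z ≠ 0 := fun h0 => hg0 (by rw [← hz, h0, zero_mul, zero_mul])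
    have hΘz0 : Θ z ≠ 0 := (map_ne_zero Θ).2 hz0
    have hzz : Valued.v z * Valued.v z = exp (2 * ((dρ : ℤ) + s0 - e)) := by
      rw [← hvg, ← hz, Valuation.map_mul, Valuation.map_mul, hvΘ, hn₀1, mul_one]
    have hzv : Valued.v z = exp ((dρ : ℤ) + s0 - e) := eq_exp_of_mul_self_eq hzz
    -- the unit `ω₀ := ϖE^{−r′}∕(n₀·z·α^{k₀})`, `r′ := d′ − r`
    have hωne : ϖE ^ (-((d' : ℤ) - r)) / (n₀ * z * α ^ k₀) ≠ 0 :=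
      div_ne_zero (zpow_ne_zero _ hϖ0) (mul_ne_zero (mul_ne_zero hn₀0 hz0) (zpow_ne_zero _ hα0))
    have hω1 : Valued.v (ϖE ^ (-((d' : ℤ) - r)) / (n₀ * z * α ^ k₀)) = 1 := by
      rw [map_div₀, Valuation.map_mul, Valuation.map_mul, map_zpow₀, map_zpow₀, hϖE, hzv, hα, hn₀1, one_mul, ← exp_zsmul, ← exp_zsmul,
        ← exp_add, ← exp_sub, ← exp_zero]
      congr 1
      simp only [smul_eq_mul]
      omega
    refine ⟨Units.mk0 _ hωne, hω1, ?_⟩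
    have hN0 : α ^ k₀ * Θ (α ^ k₀) ≠ 0 := mul_ne_zero (zpow_ne_zero _ hα0) ((map_ne_zero Θ).2 (zpow_ne_zero _ hα0))
    have hM0 : ϖE ^ (-((d' : ℤ) - r)) / (n₀ * z * α ^ k₀) * Θ (ϖE ^ (-((d' : ℤ) - r)) / (n₀ * z * α ^ k₀)) ≠ 0 :=
      mul_ne_zero hωne ((map_ne_zero Θ).2 hωne)
    rw [Units.val_mk0, div_mul_div_mul_div_eq_map_mul_div ρ hh hN0 hM0]
    have hΘα0 : Θ (α ^ k₀) ≠ 0 := (map_ne_zero Θ).2 (zpow_ne_zero _ hα0)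
    have hNϖ0 : ϖE ^ (-((d' : ℤ) - r)) * Θ (ϖE ^ (-((d' : ℤ) - r))) ≠ 0 :=
      mul_ne_zero (zpow_ne_zero _ hϖ0) ((map_ne_zero Θ).2 (zpow_ne_zero _ hϖ0))
    -- `h·N(α^{k₀})·N(ω₀) = ξ₁·N(ϖE^{−r′})∕n₀`
    have hprod : h * (α ^ k₀ * Θ (α ^ k₀)) * (ϖE ^ (-((d' : ℤ) - r)) / (n₀ * z * α ^ k₀) * Θ (ϖE ^ (-((d' : ℤ) - r)) / (n₀ * z * α ^ k₀))) =
        (P - ρ P) * (ϖE ^ (-((d' : ℤ) - r)) * Θ (ϖE ^ (-((d' : ℤ) - r)))) / n₀ := by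
      rw [hhg, ← hz, map_div₀, map_mul, map_mul, hΘn₀]
      field_simp
    have hρN : ρ (ϖE ^ (-((d' : ℤ) - r)) * Θ (ϖE ^ (-((d' : ℤ) - r)))) = ϖE ^ (-((d' : ℤ) - r)) * Θ (ϖE ^ (-((d' : ℤ) - r))) := by
      rw [map_mul, ← hΘρ, map_zpow₀ ρ, hρϖ]
    have key : ∀ A B C D : K, A ≠ 0 → B ≠ 0 → C ≠ 0 → D ≠ 0 → -A * B / C / (A * B / D) * (C / D) = -1 := by
      intro A B C D hA hB hC hD
      field_simp
    rw [hprod, map_div₀, map_mul, hρξ, hρN]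
    exact key _ _ _ _ hξ0 hNϖ0 hρn₀0 hn₀0

/-! ## §3 The parity letter `he` -/

/-- **`he : ∃ e, v_h + d_ρ = 2e`**: a Θ-fixed `h ≠ 0` has EVEN order (the Θ-datum's clause 4 on `M`) and `d_ρ = 2d′ − 2s0` is even. [cite: Serre1979, Ch. III §6 Prop. 13] -/
theorem exists_half_order_add (hevΘ : ∀ x : K, Θ x = x → x ≠ 0 → ∃ n : ℤ, Valued.v x = exp (2 * n))
    {h : K} (hΘh : Θ h = h) (hh : h ≠ 0) {vh : ℤ} (hvh : Valued.v h = exp (-vh))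
    {dρ s0 d' : ℕ} (hds : 2 * d' = dρ + 2 * s0) : ∃ e : ℤ, vh + dρ = 2 * e := by
  obtain ⟨n, hn⟩ := hevΘ h hΘh hh
  rw [hvh, exp_inj] at hn
  exact ⟨(d' : ℤ) - s0 - n, by omega⟩

end Summit.HodgeConjecture.HodgeConjecture.Cruxes.H413.F0P3cDyRamClassLettersRamM

end
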